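import Mathlib.Analysis.SpecialFunctions.Complex.CircleAddChar
import Mathlib.NumberTheory.LegendreSymbol.AddCharacter
import Mathlib.MeasureTheory.Measure.Haar.NormedSpace
import Literature.Barriers.AtomisticToContinuum.CohnElkiesNotSharp3D
import Literature.NumberTheory.LFunctions.DedekindZetaPoissonProofs
import HarnessLib

/-!
# The Cohn–Elkies bound is not sharp in `ℝ³` (Li 2022) — proofs: the discrete reduction

Companion ("`Proofs`" sibling) of `CohnElkiesNotSharp3D.lean`, towards discharging the barrier
fact `Literature.Barriers.AtomisticToContinuum.Li2022_cohnElkies3D` (R. Li, *Dual linear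
programming bounds for sphere packing via discrete reductions*, arXiv:2206.09876, Theorem 3).

## Architecture of Li's proof (§§3–6) and what is proved here

Li's Theorem 3 ("the 3-dimensional Cohn–Elkies linear programming bound is greater than
`0.18398089`") is the composite of

1. **Theorem 2 (discrete reduction, §3 pp. 6–7) with the weak-duality chain eq. (2) (§4 p. 8)**:
   an auxiliary function `f` on `ℝ^d` (Problem 1) restricts to `g = f|ℤ^d` and periodises to an
   auxiliary function `g_m` of the *discrete* Cohn–Elkies program on `ℤ_m^d` (Problem 2) with
   `g_m(0) ≤ f(0)`; the positivity `ĝ_m ≥ 0`, `ĝ_m(0) ≥ m^{-d/2} f̂(0)` is Poisson summation.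
   Any feasible point `(μ, λ = Fμ)` of the dual program (Problem 3: `λ ≥ 0`, `μ ≥ 0` on `|x| ≥ r`,
   `μ = 0` on `0 < |x| < r`, `μ(0) = (r/2)^d`) then gives
   `(r/2)^d f(0) ≥ (r/2)^d g_m(0) ≥ ∑ μ g_m = ∑ λ ĝ_m ≥ λ(0) ĝ_m(0) ≥ m^{-d/2} λ(0)`.
   **Proved here in full** (`discreteDualBound_le`), for Schwartz `f` on
   `EuclideanSpace ℝ (Fin d)`, any `m` and `R = r²` with `0 < R ≤ m²`, from the tree's
   `d`-dimensional Poisson summation formula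
   `Literature.NumberTheory.LFunctions.Fourier.tsum_eq_tsum_fourier_intLattice`, in the
   twisted–dilated form `∑_n e^{-2πi⟨n,w⟩} f(cn) = c^{-d} ∑_k f̂((k+w)/c)` (`tsum_twist_dilate`),
   and finite Fourier inversion on `(ZMod m)^ι` (`zmod_fourier_inversion`, character
   orthogonality via Mathlib's `AddChar.sum_mulShift` for the primitive character
   `ZMod.stdAddChar`; the pairing `⟨x,y⟩ = ∑ xᵢyᵢ` is Mathlib's `dotProduct`, `x ⬝ᵥ y`). The
   certificate is taken **de-normalised** (`IsDiscreteDualCertificate`: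
   `ν ≥ 0`, `ν = 0` on the shell `0 < |x|² < R`, `Re ∑_x ν(x) e^{2πi⟨x,y⟩/m} ≥ 0`, `ν(0) > 0`;
   Li's `μ` is `(r/2)^d ν/ν(0)`, and evenness of `μ` is replaced by taking real parts), with value
   `discreteDualBound = (√R/2)^d m^{-d} ∑ν/ν(0) = m^{-d/2} λ(0)`. The scaling `r ↦ √R` of
   Problem 1 (p. 5, "by replacing `f` with `x ↦ f(cx)` …") is folded into the lattice:
   `g(n) = f(cn)`, `c = r/√R`. Li's hypothesis `m ≥ 2r` is only used to see that all lifts of a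
   class `|x̄| ≥ r` have norm `≥ r`; with balanced representatives (`ZMod.valMinAbs`, Li's
   `-m/2 < x_i ≤ m/2`) this is automatic (`ZMod.natAbs_min_of_le_div_two`), and only the zero
   class needs `m ≥ r` (`R ≤ m²`).
2. **A feasible dual point for `d = 3`, `m = 53`, `r = √89` with objective `> 0.18398089`**
   (§6, proof of Theorem 3: exact rational `μ` indexed by the `3654` orbits of the signed
   permutation group on `ℤ₅₃³`, "rationals of more than 7000 digits", verified by interval
   arithmetic; data in the arXiv ancillary files only). **Vendored here as the named fact**
   `Li2022_dualCertificate53` (a finite, decidable-in-principle statement about `ℤ₅₃³`); its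
   discharge is a kernel computation planned separately (see the unit's notes).
3. The assembly `Li2022_cohnElkies3D_of_dualCertificate53 : Li2022_dualCertificate53 →
   Li2022_cohnElkies3D` (**proved**), so that the barrier fact now rests on item 2 alone.

## Sources

* R. Li, arXiv:2206.09876 (2022): §2 Theorem 1, Problem 1 (p. 5); §3 Problem 2, Theorem 2 and its
  proof (pp. 6–7); §4 Problem 3, eq. (1)–(2) (p. 8); §5 (p. 9); §6 Theorem 3 (p. 10).
* J. Neukirch, *Algebraic Number Theory*, Ch. VII (3.2) (Poisson summation; the tree's
  `DedekindZetaPoissonProofs.lean`).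

## Not here

The certificate itself (item 2) and hence `Li2022_cohnElkies3D_holds`; Li's Theorems 4–12
(other dimensions); strong duality / convergence of the discrete bounds (Li §3, §10, open).
-/

noncomputable section

open MeasureTheory Complex Finset
open scoped Real FourierTransform SchwartzMap BigOperators RealInnerProductSpace

namespace Literature.Barriers.AtomisticToContinuum

variable {ι : Type*} [Fintype ι]

section ZModFourier

variable {m : ℕ}

/-- The **squared euclidean norm of the balanced representative** of `x ∈ ℤ_m^d`: Li embeds
`ℤ_m^d` in `ℤ^d` by the coset representatives `-m/2 < x_i ≤ m/2` (Mathlib `ZMod.valMinAbs`) and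
sets `|x|² = ∑ x_i²`. [cite: Li2022, §3 (p. 6)] -/
def zmodSqNorm (x : ι → ZMod m) : ℕ := ∑ i, (x i).valMinAbs.natAbs ^ 2

/-- An additive character turns finite sums into products. [folklore] -/
theorem addChar_map_sum {A M : Type*} [AddCommMonoid A] [CommMonoid M] (ψ : AddChar A M)
    {κ : Type*} (s : Finset κ) (a : κ → A) : ψ (∑ i ∈ s, a i) = ∏ i ∈ s, ψ (a i) := by
  classical
  induction s using Finset.induction_on with
  | empty => simp
  | insert j s hj ih => rw [Finset.sum_insert hj, Finset.prod_insert hj, AddChar.map_add_eq_mul, ih]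

variable [NeZero m]

/-- **Character orthogonality on `ℤ_m^d`**: `∑_y e^{2πi⟨z,y⟩/m} = m^d [z = 0]` (product of the
one-dimensional relations, Mathlib `AddChar.sum_mulShift` for the primitive character
`ZMod.stdAddChar`). [folklore] -/
theorem sum_stdAddChar_dotProduct [DecidableEq ι] (z : ι → ZMod m) :
    ∑ y : ι → ZMod m, ZMod.stdAddChar (z ⬝ᵥ y) =
      if z = 0 then ((m : ℂ) ^ Fintype.card ι) else 0 := by
  classical
  have hprod : ∀ y : ι → ZMod m, ZMod.stdAddChar (z ⬝ᵥ y) =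
      ∏ i, ZMod.stdAddChar (z i * y i) := fun y ↦ by rw [dotProduct]; exact addChar_map_sum _ _ _
  simp_rw [hprod]
  have key := (Finset.prod_univ_sum (fun _ : ι ↦ (Finset.univ : Finset (ZMod m)))
    (fun i (t : ZMod m) ↦ ZMod.stdAddChar (z i * t))).symm
  rw [Fintype.piFinset_univ] at key
  rw [key]
  have hi : ∀ i, (∑ t : ZMod m, ZMod.stdAddChar (z i * t)) = if z i = 0 then (m : ℂ) else 0 := by
    intro i
    have := AddChar.sum_mulShift (z i) (ZMod.isPrimitive_stdAddChar m)
    simp_rw [mul_comm _ (z i)] at this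
    rw [this, ZMod.card]
    split_ifs <;> simp
  simp_rw [hi]
  split_ifs with hz
  · simp [hz]
  · have h' : ¬ ∀ i, z i = 0 := fun h ↦ hz (funext h)
    obtain ⟨i, hi⟩ := not_forall.mp h'
    exact Finset.prod_eq_zero (Finset.mem_univ i) (if_neg hi)

/-- **Fourier inversion on `ℤ_m^d`**: `a(x) = m^{-d} ∑_y â(y) e^{2πi⟨x,y⟩/m}` with
`â(y) = ∑_z a(z) e^{-2πi⟨z,y⟩/m}` (Li's summation formula (1), §4 p. 8, is this Parseval
identity). [folklore] -/
theorem zmod_fourier_inversion [DecidableEq ι] (a : (ι → ZMod m) → ℂ) (x : ι → ZMod m) :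
    a x = ((m : ℂ) ^ Fintype.card ι)⁻¹ *
      ∑ y : ι → ZMod m, (∑ z : ι → ZMod m, a z * ZMod.stdAddChar (-(z ⬝ᵥ y))) *
        ZMod.stdAddChar (x ⬝ᵥ y) := by
  classical
  have hm : ((m : ℂ) ^ Fintype.card ι) ≠ 0 := pow_ne_zero _ (Nat.cast_ne_zero.mpr (NeZero.ne m))
  simp_rw [Finset.sum_mul]
  rw [Finset.sum_comm]
  have inner : ∀ z : ι → ZMod m,
      (∑ y : ι → ZMod m, a z * ZMod.stdAddChar (-(z ⬝ᵥ y)) * ZMod.stdAddChar (x ⬝ᵥ y)) =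
        a z * (if x - z = 0 then ((m : ℂ) ^ Fintype.card ι) else 0) := by
    intro z
    rw [← sum_stdAddChar_dotProduct (x - z), Finset.mul_sum]
    refine Finset.sum_congr rfl fun y _ ↦ ?_
    rw [mul_assoc, ← AddChar.map_add_eq_mul, sub_dotProduct, neg_add_eq_sub]
  simp_rw [inner, sub_eq_zero, mul_ite, mul_zero]
  rw [Finset.sum_ite_eq, if_pos (Finset.mem_univ _), mul_comm (a x), ← mul_assoc,
    inv_mul_cancel₀ hm, one_mul]

end ZModFourier

section Poisson



/-- The point of `ℝⁿ` (euclidean) with integer coordinates `n`. [folklore] -/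
@[reducible] def zvec (n : ι → ℤ) : EuclideanSpace ℝ ι := WithLp.toLp 2 fun i ↦ (n i : ℝ)

omit [Fintype ι] in
/-- The zero integer vector is the origin. [folklore] -/
@[simp] theorem zvec_zero : zvec (0 : ι → ℤ) = 0 := by
  ext i; simp

/-- A Schwartz function is absolutely summable over `ℤⁿ ⊂ ℝⁿ`. [folklore] -/
theorem summable_norm_schwartz_zvec (g : 𝓢(EuclideanSpace ℝ ι, ℂ)) :
    Summable fun n : ι → ℤ ↦ ‖g (zvec n)‖ := by
  obtain ⟨C, hC⟩ :=
    Literature.NumberTheory.LFunctions.Fourier.schwartz_decay g (Fintype.card ι + 1)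
  have hb : (Fintype.card ι : ℝ) < ((Fintype.card ι + 1 : ℕ) : ℝ) := by push_cast; linarith
  have hb0 : (0 : ℝ) ≤ ((Fintype.card ι + 1 : ℕ) : ℝ) := by positivity
  refine Summable.of_nonneg_of_le (fun _ ↦ norm_nonneg _) (fun n ↦ ?_)
    ((Literature.NumberTheory.LFunctions.Fourier.summable_one_add_norm_rpow_neg hb).mul_left C)
  exact Literature.NumberTheory.LFunctions.Fourier.decay_comp_toLp hb0 hC _

/-- A Schwartz function is summable over `ℤⁿ ⊂ ℝⁿ`. [folklore] -/
theorem summable_schwartz_zvec (g : 𝓢(EuclideanSpace ℝ ι, ℂ)) :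
    Summable fun n : ι → ℤ ↦ g (zvec n) :=
  (summable_norm_schwartz_zvec g).of_norm

/-- The dilate `v ↦ f (c v)` of a Schwartz function, `c ≠ 0`, as a Schwartz function
(Mathlib `SchwartzMap.compCLMOfContinuousLinearEquiv`). [folklore] -/
def schwartzDilate (f : 𝓢(EuclideanSpace ℝ ι, ℂ)) {c : ℝ} (hc : c ≠ 0) :
    𝓢(EuclideanSpace ℝ ι, ℂ) :=
  SchwartzMap.compCLMOfContinuousLinearEquiv ℂ
    (ContinuousLinearEquiv.smulLeft (Units.mk0 c hc) : EuclideanSpace ℝ ι ≃L[ℝ] EuclideanSpace ℝ ι) f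

/-- `schwartzDilate f hc v = f (c v)`. [folklore] -/
theorem schwartzDilate_apply (f : 𝓢(EuclideanSpace ℝ ι, ℂ)) {c : ℝ} (hc : c ≠ 0)
    (v : EuclideanSpace ℝ ι) : schwartzDilate f hc v = f (c • v) := by
  simp [schwartzDilate]

/-- **Fourier transform of a twisted dilate**: for `F(v) = e^{-2πi⟨v,w⟩} f(cv)`, `c > 0`,
`F̂(ξ) = c⁻ⁿ f̂((ξ + w)/c)`. [folklore] -/
theorem fourier_twist_dilate (f : 𝓢(EuclideanSpace ℝ ι, ℂ)) {c : ℝ} (hc : 0 < c)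
    (w ξ : EuclideanSpace ℝ ι) :
    𝓕 (fun v : EuclideanSpace ℝ ι ↦ cexp (↑(-2 * π * ⟪v, w⟫) * I) * f (c • v)) ξ =
      ((c ^ Fintype.card ι)⁻¹ : ℝ) • 𝓕 (⇑f) (c⁻¹ • (ξ + w)) := by
  rw [Real.fourier_eq', Real.fourier_eq']
  set G' : EuclideanSpace ℝ ι → ℂ :=
    fun u ↦ cexp (↑(-2 * π * ⟪u, c⁻¹ • (ξ + w)⟫) * I) • f u with hG'
  have h1 : ∀ v : EuclideanSpace ℝ ι,
      cexp (↑(-2 * π * ⟪v, ξ⟫) * I) • (cexp (↑(-2 * π * ⟪v, w⟫) * I) * f (c • v)) =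
        G' (c • v) := by
    intro v
    simp only [hG', smul_eq_mul]
    rw [← mul_assoc, ← Complex.exp_add]
    congr 2
    rw [real_inner_smul_left, real_inner_smul_right, inner_add_right,
      show -2 * π * (c * (c⁻¹ * (⟪v, ξ⟫ + ⟪v, w⟫))) = -2 * π * (⟪v, ξ⟫ + ⟪v, w⟫) by
        field_simp]
    push_cast
    ring
  simp_rw [h1]
  rw [Measure.integral_comp_smul_of_nonneg volume G' c (hR := hc.le), finrank_euclideanSpace]

/-- The translate-dilate `v ↦ f̂((v + w)/c)` of the Fourier transform of a Schwartz function is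
summable over `ℤⁿ` (it is again a Schwartz function). [folklore] -/
theorem summable_fourier_dilate_translate (f : 𝓢(EuclideanSpace ℝ ι, ℂ)) {c : ℝ} (hc : c ≠ 0)
    (w : EuclideanSpace ℝ ι) :
    Summable fun k : ι → ℤ ↦ 𝓕 (⇑f) (c⁻¹ • (zvec k + w)) := by
  set G : 𝓢(EuclideanSpace ℝ ι, ℂ) := schwartzDilate
    (((𝓕 f : 𝓢(EuclideanSpace ℝ ι, ℂ))).compSubConstCLM ℂ (-(c⁻¹ • w))) (inv_ne_zero hc)
    with hG
  have hGapply : ∀ v, G v = 𝓕 (⇑f) (c⁻¹ • (v + w)) := by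
    intro v
    rw [hG, schwartzDilate_apply, SchwartzMap.compSubConstCLM_apply, SchwartzMap.fourier_coe,
      smul_add, sub_neg_eq_add]
  simpa only [hGapply] using summable_schwartz_zvec G

/-- **Twisted Poisson summation for a dilated Schwartz function** (from the tree's Poisson
summation on `ℤⁿ`, `Literature.NumberTheory.LFunctions.Fourier.tsum_eq_tsum_fourier_intLattice`):
for `f` Schwartz on `ℝⁿ`, `c > 0` and `w ∈ ℝⁿ`,
`∑_{n ∈ ℤⁿ} e^{-2πi⟨n,w⟩} f(cn) = c⁻ⁿ ∑_{k ∈ ℤⁿ} f̂((k + w)/c)`, both series converging absolutely.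
[cite: Li2022, §3 proof of Theorem 2] -/
theorem tsum_twist_dilate (f : 𝓢(EuclideanSpace ℝ ι, ℂ)) {c : ℝ} (hc : 0 < c)
    (w : EuclideanSpace ℝ ι) :
    ∑' n : ι → ℤ, cexp (↑(-2 * π * ⟪zvec n, w⟫) * I) * f (c • zvec n) =
      ((c ^ Fintype.card ι)⁻¹ : ℝ) • ∑' k : ι → ℤ, 𝓕 (⇑f) (c⁻¹ • (zvec k + w)) := by
  set F : EuclideanSpace ℝ ι → ℂ := fun v ↦ cexp (↑(-2 * π * ⟪v, w⟫) * I) * f (c • v) with hF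
  -- continuity
  have hFc : Continuous F := by
    rw [hF]
    refine Continuous.mul ?_ (f.continuous.comp (continuous_const_smul c))
    refine Complex.continuous_exp.comp ?_
    fun_prop
  -- decay, from the dilate being Schwartz
  set b : ℝ := ((Fintype.card ι + 1 : ℕ) : ℝ) with hb_def
  have hb : (Fintype.card ι : ℝ) < b := by rw [hb_def]; push_cast; linarith
  obtain ⟨C, hC⟩ :=
    Literature.NumberTheory.LFunctions.Fourier.schwartz_decay (schwartzDilate f hc.ne')
      (Fintype.card ι + 1)
  have hFdec : ∀ v, ‖F v‖ ≤ C * (1 + ‖v‖) ^ (-b) := by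
    intro v
    have h1 : ‖F v‖ = ‖f (c • v)‖ := by
      rw [hF]
      simp only [norm_mul, Complex.norm_exp_ofReal_mul_I, one_mul]
    rw [h1, ← schwartzDilate_apply f hc.ne' v]
    exact hC v
  -- the Fourier transform of `F` on `ℤⁿ`
  have hFF : ∀ k : ι → ℤ, 𝓕 F (zvec k) =
      ((c ^ Fintype.card ι)⁻¹ : ℝ) • 𝓕 (⇑f) (c⁻¹ • (zvec k + w)) := fun k ↦
    fourier_twist_dilate f hc w (zvec k)
  have hsumG := summable_fourier_dilate_translate f hc.ne' w
  have hsum : Summable fun k : ι → ℤ ↦ 𝓕 F (zvec k) := by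
    simp_rw [hFF]
    exact hsumG.const_smul _
  have key := Literature.NumberTheory.LFunctions.Fourier.tsum_eq_tsum_fourier_intLattice
    hFc hb hFdec hsum
  change ∑' n : ι → ℤ, F (zvec n) = _
  rw [key]
  simp_rw [hFF]
  exact hsumG.tsum_const_smul _

end Poisson

/-! ## The discrete dual certificate and the reduction (Li 2022, Theorem 2 and eq. (2)) -/

section Reduction

variable {d : ℕ} {m : ℕ} [NeZero m]

/-- Reduction of an integer vector modulo `m`. [folklore] -/
def redMod (m : ℕ) (n : Fin d → ℤ) : Fin d → ZMod m := fun i ↦ (n i : ZMod m)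

omit [NeZero m] in
/-- Coordinates of the reduction modulo `m`. [folklore] -/
@[simp] theorem redMod_apply (n : Fin d → ℤ) (i : Fin d) : redMod m n i = (n i : ZMod m) := rfl

omit [NeZero m] in
/-- The zero vector reduces to zero. [folklore] -/
@[simp] theorem redMod_zero : redMod m (0 : Fin d → ℤ) = 0 := by
  funext i; simp [redMod]

/-- **Li's discrete dual certificate, de-normalised** (Li 2022, Problem 3 / Problem 4, with the
normalisation `μ(0) = (r/2)^d` dropped, evenness replaced by taking real parts, and `r² = R`):
a real function `ν` on `ℤ_m^d` with `ν ≥ 0`, `ν(x) = 0` for `0 < |x|² < R` (`|x|` the euclidean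
norm of the balanced representative), `Re ∑_x ν(x) e^{2πi⟨x,y⟩/m} ≥ 0` for all `y`
(`⟨x,y⟩ = x ⬝ᵥ y = ∑ xᵢyᵢ`, Mathlib `dotProduct`; i.e. the Fourier transform `λ = F ν` is
non-negative) and `ν(0) > 0`. [cite: Li2022, §4 Problem 3 (p. 8)] -/
structure IsDiscreteDualCertificate (R : ℕ) (ν : (Fin d → ZMod m) → ℝ) : Prop where
  nonneg : ∀ x, 0 ≤ ν x
  eq_zero_of_lt : ∀ x, x ≠ 0 → zmodSqNorm x < R → ν x = 0
  re_sum_nonneg : ∀ y, 0 ≤ (∑ x, (ν x : ℂ) * ZMod.stdAddChar (x ⬝ᵥ y)).re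
  zero_pos : 0 < ν 0

/-- The **dual bound** `(√R/2)^d m^{-d} (∑_x ν(x)) / ν(0)` of a de-normalised certificate
(Li's objective value `m^{-d/2} λ(0)` for `μ = (r/2)^d ν/ν(0)`, `r = √R`).
[cite: Li2022, §4 Problem 3 and eq. (2) (p. 8)] -/
def discreteDualBound (R : ℕ) (ν : (Fin d → ZMod m) → ℝ) : ℝ :=
  (Real.sqrt R / 2) ^ d / (m : ℝ) ^ d * ((∑ x, ν x) / ν 0)

/-- The balanced representative is the shortest lift, coordinatewise: if `n ≡ x (mod m)` then
`|x|² ≤ ‖n‖²`. [cite: Li2022, §3 proof of Theorem 2 (p. 7)] -/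
theorem zmodSqNorm_le_norm_sq {n : Fin d → ℤ} {x : Fin d → ZMod m} (h : redMod m n = x) :
    (zmodSqNorm x : ℝ) ≤ ‖zvec n‖ ^ 2 := by
  rw [EuclideanSpace.real_norm_sq_eq, zmodSqNorm]
  push_cast
  refine Finset.sum_le_sum fun i _ ↦ ?_
  have hi : x i = (n i : ZMod m) := by rw [← h]; rfl
  have hle : (x i).valMinAbs.natAbs ≤ (n i).natAbs :=
    ZMod.natAbs_min_of_le_div_two m (x i).valMinAbs (n i) (by rw [ZMod.coe_valMinAbs, hi])
      (ZMod.natAbs_valMinAbs_le _)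
  have h1 : (((x i).valMinAbs.natAbs : ℕ) : ℝ) ≤ ((n i).natAbs : ℝ) := by exact_mod_cast hle
  have h2 : (((n i).natAbs : ℕ) : ℝ) ^ 2 = ((n i : ℝ)) ^ 2 := by
    rw [Nat.cast_natAbs, Int.cast_abs, sq_abs]
  calc (((x i).valMinAbs.natAbs : ℕ) : ℝ) ^ 2 ≤ (((n i).natAbs : ℕ) : ℝ) ^ 2 := by
        gcongr
    _ = ((n i : ℝ)) ^ 2 := h2
    _ = (zvec n i) ^ 2 := by simp

omit [NeZero m] in
/-- A non-zero integer vector reducing to `0` modulo `m` has norm at least `m`.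
[cite: Li2022, §3 proof of Theorem 2 (p. 7)] -/
theorem sq_le_norm_sq_of_redMod_eq_zero {n : Fin d → ℤ} (h : redMod m n = 0) (hn : n ≠ 0) :
    ((m : ℝ)) ^ 2 ≤ ‖zvec n‖ ^ 2 := by
  obtain ⟨i, hi⟩ : ∃ i, n i ≠ 0 := by
    by_contra h'
    exact hn (funext fun i ↦ not_not.mp (not_exists.mp h' i))
  have hdvd : (m : ℤ) ∣ n i := by
    rw [← ZMod.intCast_zmod_eq_zero_iff_dvd]
    have := congr_fun h i
    simpa [redMod] using this
  have hm : (m : ℤ) ≤ |n i| := Int.le_of_dvd (abs_pos.mpr hi) ((dvd_abs _ _).mpr hdvd)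
  have hm' : (m : ℝ) ≤ |(n i : ℝ)| := by exact_mod_cast hm
  rw [EuclideanSpace.real_norm_sq_eq]
  calc ((m : ℝ)) ^ 2 ≤ |(n i : ℝ)| ^ 2 := by gcongr
    _ = (zvec n i) ^ 2 := by simp [sq_abs]
    _ ≤ ∑ j, (zvec n j) ^ 2 :=
        Finset.single_le_sum (f := fun j ↦ (zvec n j) ^ 2) (fun j _ ↦ sq_nonneg _)
          (Finset.mem_univ i)

/-- The character identity linking `ℤ_m^d` to `ℝⁿ`: `e(-⟨n̄, ȳ⟩) = exp(-2πi ⟨n, ỹ⟩/m)` for the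
balanced lift `ỹ` of `ȳ`. [folklore] -/
theorem stdAddChar_neg_dotProduct_redMod (n : Fin d → ℤ) (y : Fin d → ZMod m) :
    (ZMod.stdAddChar (-(redMod m n ⬝ᵥ y)) : ℂ) =
      cexp (↑(-2 * π * ⟪zvec n, ((m : ℝ))⁻¹ • zvec (fun i ↦ (y i).valMinAbs)⟫) * I) := by
  have h1 : redMod m n ⬝ᵥ y = ((∑ i, n i * (y i).valMinAbs : ℤ) : ZMod m) := by
    unfold dotProduct
    push_cast
    refine Finset.sum_congr rfl fun i _ ↦ ?_
    simp
  rw [h1, ← Int.cast_neg, ZMod.stdAddChar_coe, real_inner_smul_right]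
  have h2 : ⟪zvec n, zvec (fun i ↦ (y i).valMinAbs)⟫ = ∑ i, (n i : ℝ) * ((y i).valMinAbs : ℝ) := by
    simp [zvec, PiLp.inner_apply, mul_comm]
  rw [h2]
  have hm : (m : ℂ) ≠ 0 := Nat.cast_ne_zero.mpr (NeZero.ne m)
  congr 1
  push_cast
  field_simp

variable (f : 𝓢(EuclideanSpace ℝ (Fin d), ℂ)) (c : ℝ)

/-- The **fibre sums** `a(x̄) = ∑_{n ≡ x̄ (mod m)} f(c n)` of the dilated sample of `f` on `ℤⁿ`
(Li's `g_m`, with the dilation `c` in place of Li's rescaling of `f`).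
[cite: Li2022, §3 proof of Theorem 2 (p. 7)] -/
def fiberSum (x : Fin d → ZMod m) : ℂ :=
  ∑' n : Fin d → ℤ, if redMod m n = x then f (c • zvec n) else 0

omit [NeZero m] in
/-- The terms of a fibre sum form a summable family (Schwartz decay of the dilate). [folklore] -/
theorem summable_fiberSum_term {c : ℝ} (hc : c ≠ 0) (x : Fin d → ZMod m) :
    Summable fun n : Fin d → ℤ ↦ (if redMod m n = x then f (c • zvec n) else 0 : ℂ) := by
  refine Summable.of_norm_bounded (summable_norm_schwartz_zvec (schwartzDilate f hc)) fun n ↦ ?_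
  rw [schwartzDilate_apply]
  split_ifs
  · exact le_rfl
  · rw [norm_zero]; exact norm_nonneg _

/-- **Unfolding the fibre sums**: `∑_x̄ φ(x̄) a(x̄) = ∑_{n ∈ ℤⁿ} φ(n̄) f(cn)`. [folklore] -/
theorem sum_mul_fiberSum {c : ℝ} (hc : c ≠ 0) (φ : (Fin d → ZMod m) → ℂ) :
    ∑ x, φ x * fiberSum f c x = ∑' n : Fin d → ℤ, φ (redMod m n) * f (c • zvec n) := by
  classical
  unfold fiberSum
  simp_rw [← tsum_mul_left]
  rw [← Summable.tsum_finsetSum (fun x _ ↦ (summable_fiberSum_term f hc x).mul_left (φ x))]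
  refine tsum_congr fun n ↦ ?_
  simp_rw [mul_ite, mul_zero]
  rw [Finset.sum_ite_eq]
  simp

/-- The **discrete Fourier transform of the fibre sums** (Li: `ĝ_m(y) = m^{-d/2} ĝ(y/m)`, computed
by Poisson summation): `∑_x̄ a(x̄) e^{-2πi⟨x̄,ȳ⟩/m} = c⁻ⁿ ∑_{k ∈ ℤⁿ} f̂((k + ỹ/m)/c)`.
[cite: Li2022, §3 proof of Theorem 2 (p. 7)] -/
theorem sum_fiberSum_mul_stdAddChar {c : ℝ} (hc : 0 < c) (y : Fin d → ZMod m) :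
    ∑ x, fiberSum f c x * ZMod.stdAddChar (-(x ⬝ᵥ y)) =
      ((c ^ d)⁻¹ : ℝ) • ∑' k : Fin d → ℤ,
        𝓕 (⇑f) (c⁻¹ • (zvec k + ((m : ℝ))⁻¹ • zvec (fun i ↦ (y i).valMinAbs))) := by
  have h1 : ∑ x, fiberSum f c x * ZMod.stdAddChar (-(x ⬝ᵥ y)) =
      ∑ x, (ZMod.stdAddChar (-(x ⬝ᵥ y)) : ℂ) * fiberSum f c x :=
    Finset.sum_congr rfl fun x _ ↦ mul_comm _ _
  have key := tsum_twist_dilate f hc (((m : ℝ))⁻¹ • zvec (fun i ↦ (y i).valMinAbs))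
  rw [Fintype.card_fin] at key
  rw [h1, sum_mul_fiberSum f hc.ne', ← key]
  refine tsum_congr fun n ↦ ?_
  rw [stdAddChar_neg_dotProduct_redMod]

/-- The discrete Fourier transform `Â(ȳ) = ∑_x̄ a(x̄) e^{-2πi⟨x̄,ȳ⟩/m}` of the fibre sums.
[cite: Li2022, §3 proof of Theorem 2 (p. 7)] -/
def fiberSumHat (y : Fin d → ZMod m) : ℂ := ∑ x, fiberSum f c x * ZMod.stdAddChar (-(x ⬝ᵥ y))

/-- **Positivity of the discrete Fourier transform of the fibre sums** (Li: "`ĝ_m(y) ≥ 0` for all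
`y`", "`ĝ_m(0) ≥ m^{-d/2} f̂(0)`"): if `f̂` is real and non-negative then `Â(ȳ)` is real,
non-negative, and `Â(0) ≥ c⁻ⁿ f̂(0)`. [cite: Li2022, §3 proof of Theorem 2 (p. 7)] -/
theorem fiberSumHat_re_im {c : ℝ} (hc : 0 < c) (hFf_real : ∀ ξ, (𝓕 (⇑f) ξ).im = 0)
    (hFf_nonneg : ∀ ξ, 0 ≤ (𝓕 (⇑f) ξ).re) (y : Fin d → ZMod m) :
    (fiberSumHat f c y).im = 0 ∧ 0 ≤ (fiberSumHat f c y).re ∧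
      (y = 0 → (c ^ d)⁻¹ * (𝓕 (⇑f) 0).re ≤ (fiberSumHat f c y).re) := by
  set w : EuclideanSpace ℝ (Fin d) := ((m : ℝ))⁻¹ • zvec (fun i ↦ (y i).valMinAbs) with hw
  have hsum := summable_fourier_dilate_translate f hc.ne' w
  have heq : fiberSumHat f c y =
      ((c ^ d)⁻¹ : ℝ) • ∑' k : Fin d → ℤ, 𝓕 (⇑f) (c⁻¹ • (zvec k + w)) :=
    sum_fiberSum_mul_stdAddChar f hc y
  have hc' : (0 : ℝ) ≤ (c ^ d)⁻¹ := by positivity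
  have hre : (∑' k : Fin d → ℤ, 𝓕 (⇑f) (c⁻¹ • (zvec k + w))).re =
      ∑' k : Fin d → ℤ, (𝓕 (⇑f) (c⁻¹ • (zvec k + w))).re := Complex.re_tsum hsum
  have him : (∑' k : Fin d → ℤ, 𝓕 (⇑f) (c⁻¹ • (zvec k + w))).im = 0 := by
    rw [Complex.im_tsum hsum]
    simp [hFf_real]
  have hsum_re : Summable fun k : Fin d → ℤ ↦ (𝓕 (⇑f) (c⁻¹ • (zvec k + w))).re :=
    (Complex.hasSum_re hsum.hasSum).summable
  refine ⟨?_, ?_, ?_⟩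
  · rw [heq, Complex.smul_im, him, smul_zero]
  · rw [heq, Complex.smul_re, hre, smul_eq_mul]
    exact mul_nonneg hc' (tsum_nonneg fun k ↦ hFf_nonneg _)
  · intro hy
    subst hy
    have hw0 : w = 0 := by
      rw [hw]
      have : (fun i ↦ ((0 : Fin d → ZMod m) i).valMinAbs) = (0 : Fin d → ℤ) := by
        funext i; simp
      rw [this, zvec_zero, smul_zero]
    rw [heq, Complex.smul_re, hre, smul_eq_mul]
    refine mul_le_mul_of_nonneg_left ?_ hc'
    have h0 : (𝓕 (⇑f) 0).re = (𝓕 (⇑f) (c⁻¹ • (zvec (0 : Fin d → ℤ) + w))).re := by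
      rw [zvec_zero, hw0, add_zero, smul_zero]
    rw [h0]
    exact hsum_re.le_tsum 0 fun k _ ↦ hFf_nonneg _

/-- **The fibre sums are non-positive off the forbidden shell** (Li: "`g_m(x) ≤ 0` for `|x| ≥ r`",
here with `r² = R`, `c = r/√R`): every `n ≡ x̄` has `‖cn‖ ≥ c|x̄| ≥ r`.
[cite: Li2022, §3 proof of Theorem 2 (p. 7)] -/
theorem fiberSum_re_nonpos {R : ℕ} (hR : 0 < R) {r : ℝ} (hr : 0 < r)
    (hf_nonpos : ∀ x, r ≤ ‖x‖ → (f x).re ≤ 0) {x : Fin d → ZMod m}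
    (hx : R ≤ zmodSqNorm x) :
    (fiberSum f (r / Real.sqrt R) x).re ≤ 0 := by
  have hRpos : (0 : ℝ) < Real.sqrt R := Real.sqrt_pos.mpr (Nat.cast_pos.mpr hR)
  have hc : 0 < r / Real.sqrt R := div_pos hr hRpos
  unfold fiberSum
  rw [Complex.re_tsum (summable_fiberSum_term f hc.ne' x)]
  refine tsum_nonpos fun n ↦ ?_
  by_cases h : redMod m n = x
  · rw [if_pos h]
    apply hf_nonpos
    have h1 : (R : ℝ) ≤ ‖zvec n‖ ^ 2 :=
      le_trans (by exact_mod_cast hx) (zmodSqNorm_le_norm_sq h)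
    have h2 : Real.sqrt R ≤ ‖zvec n‖ := by
      rw [← Real.sqrt_sq (norm_nonneg (zvec n))]
      exact Real.sqrt_le_sqrt h1
    rw [norm_smul, Real.norm_eq_abs, abs_of_pos hc]
    calc r = r / Real.sqrt R * Real.sqrt R := by field_simp
      _ ≤ r / Real.sqrt R * ‖zvec n‖ := mul_le_mul_of_nonneg_left h2 hc.le
  · rw [if_neg h]
    simp

omit [NeZero m] in
/-- **The zero fibre sum is at most `f(0)`** (Li: "`g_m(0) = ∑_{n ∈ mℤ^d} g(n) ≤ g(0) = f(0)`",
which needs only `m ≥ r`, i.e. `R ≤ m²`). [cite: Li2022, §3 proof of Theorem 2 (p. 7)] -/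
theorem fiberSum_zero_re_le {R : ℕ} (hR : 0 < R) (hRm : R ≤ m ^ 2) {r : ℝ} (hr : 0 < r)
    (hf_nonpos : ∀ x, r ≤ ‖x‖ → (f x).re ≤ 0) :
    (fiberSum f (r / Real.sqrt R) (0 : Fin d → ZMod m)).re ≤ (f 0).re := by
  classical
  have hRpos : (0 : ℝ) < Real.sqrt R := Real.sqrt_pos.mpr (Nat.cast_pos.mpr hR)
  have hc : 0 < r / Real.sqrt R := div_pos hr hRpos
  unfold fiberSum
  rw [Complex.re_tsum (summable_fiberSum_term f hc.ne' 0)]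
  have hle : ∀ n : Fin d → ℤ,
      (if redMod m n = 0 then f ((r / Real.sqrt R) • zvec n) else 0 : ℂ).re ≤
        (if n = 0 then (f 0).re else 0) := by
    intro n
    by_cases hn : n = 0
    · subst hn
      simp
    · rw [if_neg hn]
      by_cases h : redMod m n = 0
      · rw [if_pos h]
        apply hf_nonpos
        have h1 : (R : ℝ) ≤ ‖zvec n‖ ^ 2 := by
          refine le_trans ?_ (sq_le_norm_sq_of_redMod_eq_zero h hn)
          exact_mod_cast hRm
        have h2 : Real.sqrt R ≤ ‖zvec n‖ := by
          rw [← Real.sqrt_sq (norm_nonneg (zvec n))]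
          exact Real.sqrt_le_sqrt h1
        rw [norm_smul, Real.norm_eq_abs, abs_of_pos hc]
        calc r = r / Real.sqrt R * Real.sqrt R := by field_simp
          _ ≤ r / Real.sqrt R * ‖zvec n‖ := mul_le_mul_of_nonneg_left h2 hc.le
      · rw [if_neg h]
        simp
  calc (∑' n : Fin d → ℤ, (if redMod m n = 0 then f ((r / Real.sqrt R) • zvec n) else 0 : ℂ).re)
      ≤ ∑' n : Fin d → ℤ, (if n = 0 then (f 0).re else 0) :=
        Summable.tsum_le_tsum hle (Complex.hasSum_re (summable_fiberSum_term f hc.ne' 0).hasSum).summable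
          (hasSum_ite_eq (0 : Fin d → ℤ) (f 0).re).summable
    _ = (f 0).re := tsum_ite_eq (0 : Fin d → ℤ) (fun _ ↦ (f 0).re)

/-- **Li's discrete reduction with weak duality** (Li 2022, Theorem 2 with eq. (2) of §4): a
de-normalised discrete dual certificate `ν` on `ℤ_m^d` with parameter `R = r²`, `0 < R ≤ m²`,
bounds the Cohn–Elkies value of every admissible Schwartz auxiliary function on `ℝ^d` from below:
`(√R/2)^d m^{-d} ∑ν/ν(0) ≤ (r/2)^d f(0)/f̂(0)`. (Li assumes `m ≥ 2r`; with balanced representatives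
only the zero fibre needs `m ≥ r`.) The proof is Li's chain
`(r/2)^d f(0) ≥ (r/2)^d g_m(0) ≥ ∑ μ g_m = ∑ λ ĝ_m ≥ λ(0) ĝ_m(0) ≥ m^{-d/2} λ(0)` for
`g_m = ` fibre sums of `x ↦ f(rx/√R)` on `ℤ^d`, with Poisson summation supplying `ĝ_m ≥ 0`.
[cite: Li2022, §3 Theorem 2 (pp. 6–7) and §4 eq. (2) (p. 8)] -/
theorem discreteDualBound_le {R : ℕ} (hR : 0 < R) (hRm : R ≤ m ^ 2)
    {ν : (Fin d → ZMod m) → ℝ} (hν : IsDiscreteDualCertificate R ν)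
    (f : 𝓢(EuclideanSpace ℝ (Fin d), ℂ)) {r : ℝ} (hr : 0 < r)
    (hFf_real : ∀ ξ, (𝓕 (⇑f) ξ).im = 0) (hFf0 : 0 < (𝓕 (⇑f) 0).re)
    (hf_nonpos : ∀ x, r ≤ ‖x‖ → (f x).re ≤ 0) (hFf_nonneg : ∀ ξ, 0 ≤ (𝓕 (⇑f) ξ).re) :
    discreteDualBound R ν ≤ (r / 2) ^ d * (f 0).re / (𝓕 (⇑f) 0).re := by
  classical
  -- notation
  have hRpos : (0 : ℝ) < Real.sqrt R := Real.sqrt_pos.mpr (Nat.cast_pos.mpr hR)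
  set c : ℝ := r / Real.sqrt R with hc_def
  have hc : 0 < c := div_pos hr hRpos
  have hm : (0 : ℝ) < m := Nat.cast_pos.mpr (Nat.pos_of_ne_zero (NeZero.ne m))
  set a : (Fin d → ZMod m) → ℂ := fiberSum f c with ha_def
  set A : (Fin d → ZMod m) → ℂ := fiberSumHat f c with hA_def
  set N : (Fin d → ZMod m) → ℂ := fun y ↦ ∑ x, (ν x : ℂ) * ZMod.stdAddChar (x ⬝ᵥ y) with hN_def
  set S : ℂ := ∑ x, (ν x : ℂ) * a x with hS_def
  -- Step 1: `Re S ≤ ν(0) f(0)`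
  have hS_le : S.re ≤ ν 0 * (f 0).re := by
    rw [hS_def, Complex.re_sum]
    simp_rw [Complex.re_ofReal_mul]
    calc ∑ x, ν x * (a x).re
        ≤ ∑ x : Fin d → ZMod m, (if x = 0 then ν 0 * (f 0).re else 0) := by
          refine Finset.sum_le_sum fun x _ ↦ ?_
          by_cases hx : x = 0
          · subst hx
            rw [if_pos rfl]
            exact mul_le_mul_of_nonneg_left (fiberSum_zero_re_le f hR hRm hr hf_nonpos)
              (hν.nonneg 0)
          · rw [if_neg hx]
            by_cases hlt : zmodSqNorm x < R
            · rw [hν.eq_zero_of_lt x hx hlt, zero_mul]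
            · exact mul_nonpos_iff.mpr (Or.inl ⟨hν.nonneg x,
                fiberSum_re_nonpos f hR hr hf_nonpos (not_lt.mp hlt)⟩)
      _ = ν 0 * (f 0).re := by rw [Finset.sum_ite_eq']; simp
  -- Step 2: Fourier expansion `S = m^{-d} ∑_y Â(y) N(y)`
  have hS_eq : S = ((m : ℂ) ^ d)⁻¹ * ∑ y, A y * N y := by
    have hinv : ∀ x, a x = ((m : ℂ) ^ d)⁻¹ * ∑ y, A y * ZMod.stdAddChar (x ⬝ᵥ y) :=
      fun x ↦ by
        have h := zmod_fourier_inversion a x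
        rw [Fintype.card_fin] at h
        exact h
    rw [hS_def]
    simp_rw [hinv, hN_def, Finset.mul_sum]
    rw [Finset.sum_comm]
    refine Finset.sum_congr rfl fun y _ ↦ ?_
    refine Finset.sum_congr rfl fun x _ ↦ ?_
    ring
  -- Step 3: `Re S ≥ m^{-d} c^{-d} f̂(0) ∑ν`
  have hS_ge : ((m : ℝ) ^ d)⁻¹ * ((c ^ d)⁻¹ * (𝓕 (⇑f) 0).re * ∑ x, ν x) ≤ S.re := by
    have hcast : ((m : ℂ) ^ d)⁻¹ = ((((m : ℝ) ^ d)⁻¹ : ℝ) : ℂ) := by push_cast; rfl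
    rw [hS_eq, hcast, Complex.re_ofReal_mul, Complex.re_sum]
    refine mul_le_mul_of_nonneg_left ?_ (by positivity)
    have hterm : ∀ y, (A y * N y).re = (A y).re * (N y).re := by
      intro y
      rw [Complex.mul_re, (fiberSumHat_re_im f hc hFf_real hFf_nonneg y).1, zero_mul, sub_zero]
    simp_rw [hterm]
    have hN0 : (N 0).re = ∑ x, ν x := by
      rw [hN_def]
      simp only [dotProduct_zero, AddChar.map_zero_eq_one, mul_one]
      rw [Complex.re_sum]
      simp
    calc (c ^ d)⁻¹ * (𝓕 (⇑f) 0).re * ∑ x, ν x ≤ (A 0).re * (N 0).re := by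
          rw [hN0]
          exact mul_le_mul_of_nonneg_right
            ((fiberSumHat_re_im f hc hFf_real hFf_nonneg 0).2.2 rfl)
            (Finset.sum_nonneg fun x _ ↦ hν.nonneg x)
      _ ≤ ∑ y, (A y).re * (N y).re :=
          Finset.single_le_sum (f := fun y ↦ (A y).re * (N y).re)
            (fun y _ ↦ mul_nonneg (fiberSumHat_re_im f hc hFf_real hFf_nonneg y).2.1
              (hν.re_sum_nonneg y)) (Finset.mem_univ 0)
  -- Step 4: algebra
  have key : ((m : ℝ) ^ d)⁻¹ * ((c ^ d)⁻¹ * (𝓕 (⇑f) 0).re * ∑ x, ν x) ≤ ν 0 * (f 0).re :=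
    hS_ge.trans hS_le
  have hmd : (0 : ℝ) < (m : ℝ) ^ d := by positivity
  have hcd : (0 : ℝ) < c ^ d := by positivity
  have hsd : (0 : ℝ) < Real.sqrt R ^ d := by positivity
  have key2 : (𝓕 (⇑f) 0).re * ∑ x, ν x ≤ c ^ d * ((m : ℝ) ^ d * (ν 0 * (f 0).re)) := by
    rw [inv_mul_le_iff₀ hmd, mul_assoc, inv_mul_le_iff₀ hcd] at key
    exact key
  have hcd_eq : c ^ d = r ^ d / Real.sqrt R ^ d := by rw [hc_def, div_pow]
  have key3 : Real.sqrt R ^ d * ((𝓕 (⇑f) 0).re * ∑ x, ν x) ≤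
      r ^ d * ((m : ℝ) ^ d * (ν 0 * (f 0).re)) := by
    rw [hcd_eq, div_mul_eq_mul_div, le_div_iff₀ hsd] at key2
    linarith
  have hν0 : ν 0 ≠ 0 := hν.zero_pos.ne'
  have hm0 : (m : ℝ) ^ d ≠ 0 := hmd.ne'
  have h2d : (2 : ℝ) ^ d ≠ 0 := pow_ne_zero _ two_ne_zero
  rw [le_div_iff₀ hFf0, discreteDualBound, div_pow, div_pow]
  rw [show Real.sqrt R ^ d / 2 ^ d / (m : ℝ) ^ d * ((∑ x, ν x) / ν 0) * (𝓕 (⇑f) 0).re =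
      (Real.sqrt R ^ d * ((𝓕 (⇑f) 0).re * ∑ x, ν x)) / (2 ^ d * (m : ℝ) ^ d * ν 0) by
    field_simp]
  rw [show r ^ d / 2 ^ d * (f 0).re = (r ^ d * ((m : ℝ) ^ d * (ν 0 * (f 0).re))) /
      (2 ^ d * (m : ℝ) ^ d * ν 0) by field_simp]
  exact div_le_div_of_nonneg_right key3
    (mul_pos (mul_pos (pow_pos two_pos _) hmd) hν.zero_pos).le

end Reduction

/-! ## Li's certificate for `d = 3` (named fact) and the assembly -/

section DimThree

/-- **NAMED FACT — Li's dual certificate in dimension three** (the computational content of the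
proof of Li 2022, Theorem 3): "Using `m = 53` and `r = √89`, we find a feasible point to
Problem 4 [the radialized discrete dual Cohn–Elkies linear program in `ℤ₅₃³`] whose objective
value, truncated (i.e., rounded down) to eight decimal points, is `0.18398089`" — the exact
rational dual auxiliary function `μ` (indexed by `ℤ₅₃³/G₃`, rationals of more than 7000 digits) and
its exact objective value `m^{-3/2} λ₀ > 0.18398089` being given in the paper's arXiv ancillary
files. Stated de-normalised (`IsDiscreteDualCertificate`, `discreteDualBound`): Li's feasible
`μ` (even, `μ ≥ 0`, `μ = 0` for `0 < |x|² < 89`, `λ = Fμ ≥ 0`, `μ(0) = (√89/2)³`) is such a `ν`,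
with `discreteDualBound 89 μ = (√89/2)³ · 53⁻³ · ∑μ/μ(0) = 53⁻³ ∑_x μ(x) = 53^{-3/2} λ(0)`, Li's
objective value. A finite statement about real
weights on the `53³ = 148877` points of `ℤ₅₃³`; not yet kernel-checked here.
[cite: Li2022, §6 Theorem 3 and its proof (p. 10), with §5 (p. 9) and the arXiv ancillary files] -/
def Li2022_dualCertificate53 : Prop :=
  ∃ ν : (Fin 3 → ZMod 53) → ℝ, IsDiscreteDualCertificate 89 ν ∧
    (18398089 / 100000000 : ℝ) < discreteDualBound 89 ν

/-- **Assembly: Li's certificate implies the barrier fact** `Li2022_cohnElkies3D` (Li 2022,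
Theorem 3 from Theorem 2, eq. (2) and the `d = 3` certificate): for every Schwartz `f` on `ℝ³`
and `r > 0` with `IsCohnElkiesAux f r`, `0.18398089 < (r/2)³ f(0)/f̂(0)`.
[cite: Li2022, §6 Theorem 3 (p. 10)] -/
theorem Li2022_cohnElkies3D_of_dualCertificate53 (h : Li2022_dualCertificate53) :
    Li2022_cohnElkies3D := by
  obtain ⟨ν, hν, hB⟩ := h
  intro f r hr hf
  obtain ⟨_, hFreal, _, hF0, hnonpos, hnonneg⟩ := hf
  have hle := discreteDualBound_le (d := 3) (m := 53) (R := 89) (by norm_num) (by norm_num)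
    hν f hr hFreal hF0 hnonpos hnonneg
  exact lt_of_lt_of_le hB hle

end DimThree

end Literature.Barriers.AtomisticToContinuum

end
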